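import Summits.QuantumFields.BalabanUV.Beta.WardBorderReflectionWallJoint

/-!
# `BalabanUV.Beta.WardBorderReflectionModelDefect` — binder row D1, (L4): «D1-hRhW-SOCKET-CONSISTENCY» corollary — THE WARD DEFECT OF THE OWNER's
# MODEL BORDER TABLE: `W(Twall) = F − Sym₄ F` (the hW border letter fails for `vh₂SModel` by EXACTLY the four-axis reflection average of the datum)

HONEST FRAMING (cell charter, verbatim): «discharging BetaPertH makes Balaban's UV stability UNCONDITIONAL — a real
constructive-QFT result; it is NOT the continuum limit and NOT the Clay problem.»  Neutral [folklore] algebra: part 1's step calculus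
(`WardBorderReflection.wardOp_linear`, `wardOp_actB`) tracks a Ward DEFECT `G` through the owner's step (`ward_stepB_defect`: `W(T) = F − G` and the
consistency identity for `B` ⟹ `W(stepB_α B T) = F − ½(G + act′_α G)`); started at `T := 0` (defect `F`), the four steps of K-L2b's `Twall` leave
the defect `A₃A₂A₁A₀ F`, `A_α G := ½(G + act′_α G)` — the reflection-group average of the hW datum (part 2e's `Bwall_ward_eq_defect` supplies the
four consistency identities).  Answers XREAD INFO-2 of leaf-01-g6 (journal 2026-08-20, on leaf-06's C1∕C2): the hW border letter hBord0 for the MODEL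
border table `vh₂SModel = cB⁻¹•Twall` holds EXACTLY iff that average vanishes identically; in general the model needs the correction by an hW border
model (`WardBorderReflectionWallJoint.joint_of_ward_model`).  No statement of Bałaban's papers, no `[cite:]`, no `def`; instantiates NO binder of the
β-function wall (0/4: hW, hR, D1Tel, D1Rep); NOT hW, NOT hR, NOT D1, NOT `BetaPertH`, NOT continuum, NOT Clay.
HONEST DEPENDENCY: continuum YM on T⁴ ⇐ BetaPertH ∧ nine spine estimates (0/9 proved); BetaPertH ⇐ (D1) ∧ (D4) ∧ CAP+tail;
G-an2-4 gates asym, D1 and NE2/3/4.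

CONTENT: §1 (generic `d`) `wardOp_zero`, **`ward_stepB_defect`**; §2 (`d = 3`, odd `Lc`, the END's `hγ`) **`ward_Twall`**:
`Lc⁻⁴ • Σ_v divV (κ u ↦ 1 • Twall Lc cΛ γ κ u κ′ u′) (Lc•Y+v) = F Y κ′ u′ − (A₃ (A₂ (A₁ (A₀ F)))) Y κ′ u′`, the `A_α` written out.
Provenance: β sub-cell, D1 formalisation swarm, unit b2b-balaban-beta-d1-formalise-leaf-04 gen 4, 2026-08-20 (v1); no existing file touched.
-/

open Finset
open scoped BigOperators
open Literature.MathematicalPhysics.QuantumFieldTheory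
open Literature.MathematicalPhysics.QuantumFieldTheory.Balaban1983to89
open Literature.MathematicalPhysics.QuantumFieldTheory.Balaban1983to89.Beta
open ExpKernelCalculus (MKer)
open AffineAveraging (box toSite)
open AveragingContoursRooted (ctrOff)
open AveragingHessianKernelsRooted (vhSAt)
open KernelWard (divV)
open PolarizationSign (reflSign)
open KernelReflection (LegMap refK refK_apply)
open ResolventReflection (sref bref Φ)
open OneStepResolventKernel (Fib)
open BalabanStepJetsSucc (wVH)
open Summit.QuantumFields.BalabanUV.Beta.TameKernelCalculus
open Summit.QuantumFields.BalabanUV.Beta.ChartConjugation (conjV)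
open Summit.QuantumFields.BalabanUV.Beta.BorderedHessian (diagK stepScale)
open Summit.QuantumFields.BalabanUV.Beta.AveragingWardRootedStencils (legInd)
open Summit.QuantumFields.BalabanUV.Beta.E3LevelOneReflection (refK_sub refK_smul)
open Summit.QuantumFields.BalabanUV.Beta.SecondOrderBorderGauge (actB)
open Summit.QuantumFields.BalabanUV.Beta.SecondOrderBorderCocycle (stepB)
open Summit.QuantumFields.BalabanUV.Beta.SecondOrderBorderModel (Bwall Twall)
open Summit.QuantumFields.BalabanUV.Beta.WardBorderReflection (wardOp_linear wardOp_actB divV_smul')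
open Summit.QuantumFields.BalabanUV.Beta.WardBorderReflectionWallJoint (Bwall_ward_eq_defect)

namespace Summit.QuantumFields.BalabanUV.Beta.WardBorderReflectionModelDefect

noncomputable section

variable {d : ℕ}

/-! ## §1 The defect through one step -/

section Defect

variable {N Lc : ℕ} {α : Fin (d + 1)} {s c : ℝ}
  {T B : Fin (d + 1) → (Fin (d + 1) → ℤ) → Fin (d + 1) → (Fin (d + 1) → ℤ) → MKer (d + 1) (Fib d)}
  {F G : (Fin (d + 1) → ℤ) → Fin (d + 1) → (Fin (d + 1) → ℤ) → MKer (d + 1) (Fib d)}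

/-- [folklore] The block Ward operator of the zero table vanishes. -/
theorem wardOp_zero (Lc : ℕ) (s c : ℝ) (Y : Fin (d + 1) → ℤ) (κ' : Fin (d + 1)) (u' : Fin (d + 1) → ℤ) :
    s • ∑ v ∈ box (d + 1) Lc, divV (fun κ u =>
      c • (0 : Fin (d + 1) → (Fin (d + 1) → ℤ) → Fin (d + 1) → (Fin (d + 1) → ℤ) → MKer (d + 1) (Fib d)) κ u κ' u')
        ((Lc : ℤ) • Y + toSite v) = 0 := by
  have e : ∀ v ∈ box (d + 1) Lc, divV (fun κ u =>
      c • (0 : Fin (d + 1) → (Fin (d + 1) → ℤ) → Fin (d + 1) → (Fin (d + 1) → ℤ) → MKer (d + 1) (Fib d)) κ u κ' u')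
        ((Lc : ℤ) • Y + toSite v) = 0 := by
    intro v _
    simp only [KernelWard.divV, Pi.zero_apply, smul_zero, sub_self, Finset.sum_const_zero]
  rw [Finset.sum_congr rfl e, Finset.sum_const_zero, smul_zero]

/-- [folklore] **THE WARD DEFECT THROUGH THE OWNER's STEP**: if `W(T) = F − G` and the contact `B` satisfies the consistency identity for the datum `F`,
then `W(stepB_α B T) = F − ½•(G + act′_α G)`, `(act′_α G) Y κ′ u′ := ε_α(κ′) • refK_α (G (sref α Y) κ′ (bref α κ′ u′))`. -/
theorem ward_stepB_defect
    (hW : ∀ (Y : Fin (d + 1) → ℤ) (κ' : Fin (d + 1)) (u' : Fin (d + 1) → ℤ),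
      s • ∑ v ∈ box (d + 1) Lc, divV (fun κ u => c • T κ u κ' u') ((Lc : ℤ) • Y + toSite v) = F Y κ' u' - G Y κ' u')
    (hC : ∀ (Y : Fin (d + 1) → ℤ) (κ' : Fin (d + 1)) (u' : Fin (d + 1) → ℤ),
      s • ∑ v ∈ box (d + 1) Lc, divV (fun κ u => c • B κ u κ' u') ((Lc : ℤ) • Y + toSite v) =
        reflSign α κ' • refK (Φ (d := d) N α) (F (sref α Y) κ' (bref α κ' u')) - F Y κ' u')
    (Y : Fin (d + 1) → ℤ) (κ' : Fin (d + 1)) (u' : Fin (d + 1) → ℤ) :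
    s • ∑ v ∈ box (d + 1) Lc, divV (fun κ u => c • stepB N α B T κ u κ' u') ((Lc : ℤ) • Y + toSite v) =
      F Y κ' u' - (1 / 2 : ℝ) • (G Y κ' u' + reflSign α κ' • refK (Φ (d := d) N α) (G (sref α Y) κ' (bref α κ' u'))) := by
  have e : stepB N α B T = (1 / 2 : ℝ) • (T + actB N α T) + (-(1 / 2 : ℝ)) • B := by
    unfold SecondOrderBorderCocycle.stepB; rw [neg_smul, sub_eq_add_neg]
  have e' : T + actB N α T = (1 : ℝ) • T + (1 : ℝ) • actB N α T := by rw [one_smul, one_smul]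
  rw [e, wardOp_linear, e', wardOp_linear, wardOp_actB N α Lc s c T Y κ' u', hW, hW, hC, refK_sub, smul_sub]
  module

end Defect

/-! ## §2 The Ward defect of `Twall` -/

section Wall

variable {Lc : ℕ} [NeZero Lc]

/-- [folklore] **THE hW BORDER LETTER FAILS FOR THE MODEL TABLE BY THE REFLECTION AVERAGE OF ITS DATUM**: with
`F Y κ′ u′ := conjV ((−Lc⁸∕2) • vhSAt ρ_c 3 Lc rfl κ′ u′) (diagK (½ • Σ_v legInd ρ_c (Lc•Y+v)))` and `A_α G := ½•(G + act′_α G)`,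
`Lc⁻⁴ • Σ_v divV (κ u ↦ 1 • Twall Lc cΛ γ κ u κ′ u′) (Lc•Y+v) = F Y κ′ u′ − (A₃ (A₂ (A₁ (A₀ F)))) Y κ′ u′` — so `vh₂SModel = cB⁻¹•Twall` solves the
END's hBord0 with `RB₀ := 0` iff `A₃A₂A₁A₀ F = 0`. -/
theorem ward_Twall (hLc : Odd Lc) (cΛ : ℝ) (γ : ℕ → ℝ)
    (hγ : ∀ j, γ j = -((Lc : ℝ) ^ 8 / 2) * wVH 3 Lc j / (stepScale 3 Lc j * (Lc : ℝ) ^ 4))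
    (Y : Fin 4 → ℤ) (κ' : Fin 4) (u' : Fin 4 → ℤ) :
    let F : (Fin 4 → ℤ) → Fin 4 → (Fin 4 → ℤ) → MKer 4 (Fib 3) := fun Y κ' u' =>
      conjV ((-((Lc : ℝ) ^ 8 / 2)) • vhSAt (toSite (ctrOff 4 Lc)) 3 Lc rfl κ' u')
        (diagK ((1 / 2 : ℝ) • ∑ v ∈ box 4 Lc, legInd (toSite (ctrOff 4 Lc)) ((Lc : ℤ) • Y + toSite v)))
    let A : Fin 4 → ((Fin 4 → ℤ) → Fin 4 → (Fin 4 → ℤ) → MKer 4 (Fib 3)) → ((Fin 4 → ℤ) → Fin 4 → (Fin 4 → ℤ) → MKer 4 (Fib 3)) :=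
      fun α G Y κ' u' => (1 / 2 : ℝ) • (G Y κ' u' + reflSign α κ' • refK (Φ (d := 3) Lc α) (G (sref α Y) κ' (bref α κ' u')))
    (((Lc : ℝ) ^ 4)⁻¹) • ∑ v ∈ box 4 Lc, divV (fun κ u => (1 : ℝ) • Twall Lc cΛ γ κ u κ' u') ((Lc : ℤ) • Y + toSite v) =
      F Y κ' u' - (A 3 (A 2 (A 1 (A 0 F)))) Y κ' u' := by
  intro F A
  -- the consistency identities in the `c = 1` spelling
  have hId : ∀ (α : Fin 4) (Y : Fin 4 → ℤ) (κ' : Fin 4) (u' : Fin 4 → ℤ),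
      (((Lc : ℝ) ^ 4)⁻¹) • ∑ v ∈ box 4 Lc, divV (fun κ u => (1 : ℝ) • Bwall Lc cΛ γ α κ u κ' u') ((Lc : ℤ) • Y + toSite v) =
        reflSign α κ' • refK (Φ (d := 3) Lc α) (F (sref α Y) κ' (bref α κ' u')) - F Y κ' u' := by
    intro α Y κ' u'
    have e : (fun κ u => (1 : ℝ) • Bwall Lc cΛ γ α κ u κ' u') = fun κ u => Bwall Lc cΛ γ α κ u κ' u' := by
      funext κ u; rw [one_smul]
    rw [e]
    exact Bwall_ward_eq_defect hLc cΛ γ hγ α Y κ' u'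
  -- start: the zero table has defect `F`
  have h0 : ∀ (Y : Fin 4 → ℤ) (κ' : Fin 4) (u' : Fin 4 → ℤ),
      (((Lc : ℝ) ^ 4)⁻¹) • ∑ v ∈ box 4 Lc, divV (fun κ u =>
        (1 : ℝ) • (0 : Fin 4 → (Fin 4 → ℤ) → Fin 4 → (Fin 4 → ℤ) → MKer 4 (Fib 3)) κ u κ' u') ((Lc : ℤ) • Y + toSite v) =
        F Y κ' u' - F Y κ' u' := by
    intro Y κ' u'; rw [wardOp_zero, sub_self]
  have h1 := fun Y κ' u' => ward_stepB_defect (N := Lc) (α := (0 : Fin 4)) (B := Bwall Lc cΛ γ 0) h0 (hId 0) Y κ' u'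
  have h2 := fun Y κ' u' => ward_stepB_defect (N := Lc) (α := (1 : Fin 4)) (B := Bwall Lc cΛ γ 1) h1 (hId 1) Y κ' u'
  have h3 := fun Y κ' u' => ward_stepB_defect (N := Lc) (α := (2 : Fin 4)) (B := Bwall Lc cΛ γ 2) h2 (hId 2) Y κ' u'
  have h4 := fun Y κ' u' => ward_stepB_defect (N := Lc) (α := (3 : Fin 4)) (B := Bwall Lc cΛ γ 3) h3 (hId 3) Y κ' u'
  exact h4 Y κ' u'

end Wall

end

end Summit.QuantumFields.BalabanUV.Beta.WardBorderReflectionModelDefect
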